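import Summits.QuantumFields.YangMills.Theorems.BalabanUVNodesN15TwoSpacingGluingCurvedKnitDefect
import Summits.QuantumFields.YangMills.Theorems.BalabanUVNodesN15TwoSpacingGluingCurvedKnitSmallField
import Summits.QuantumFields.YangMills.Theorems.BalabanUVNodesN15CurvedCoefOneDictionary
import Summits.QuantumFields.YangMills.Theorems.BalabanUVNodesN15CurvedTransporterOrthogonalityUN
import Summits.QuantumFields.YangMills.Theorems.BalabanUVNodesN15AdjointTransportExp
import Summits.QuantumFields.YangMills.Theorems.BalabanUVNodesN15VectorPieceV1Coarse
import Summits.QuantumFields.YangMills.Theorems.BalabanUVNodesN15VectorPieceV1Gauge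
import Summits.QuantumFields.YangMills.Theorems.BalabanUVNodesN15NeumannCubeSeam
import HarnessLib

/-!
# THE GLUING STEP AT TWO LATTICE SPACINGS — (Λ2b) THE TWO-SPACING η-DEFECT OF THE LIVE-BACKGROUND GLUED PROPAGATORS IN THE GLOBAL SMALL-FIELD GAUGE, EVERY ROW PRODUCED, WITH RATE:
# FILE 123 `uN_idef_cvGlued` for a skew-Hermitian fine gauge field `A′` in the C² small-field window and its King block mean `Ā′` (dag-n15-c g16, FILE 130; N15 = NE2, s1)

Cell `pub-ymgap`, seat `pub-ymgap-dag-n15-c` (R134 (a); HUMAN RULING D-0062), generation 16.  `bears_on: R4∕N15 · K3⁸ SpineGivenEndpointR13SepCoPHV (stmt-QuantumFields-27366)`.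
Filed `--kind proof --supports stmt-QuantumFields-27366 --as helper` — COUNT-NEUTRAL.  Theorems only; 0 `def`, 0 `sorry`.  Imports BY NAME FILE 123 `…TwoSpacingGluingCurvedKnitDefect`
(`uN_idef_cvGlued`), dag-n15-w2 `…CurvedCoefOneDictionary` (`twoSidedLetters_curvCoef_one_of_meanGauge` — dag-n15-c FILE 30 `twoSidedLettersX_of_meanGauge` re-keyed; `curvCoefC_one`∕
`curvCoefA_one`), `…CurvedTransporterOrthogonalityUN` (`coordMat_adCLM_transpose_eq_neg_of_conjTranspose`), `…AdjointTransportExp` (`Phi0_adCLM_eq_mulLeftRight`,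
`conjTranspose_exp_smul_of_conjTranspose`), dag-n15-c `…VectorPieceV1Coarse`∕`…V1Gauge` (`kingPrV_bshiftEquiv_pow`, `fibre_conn_kingPrV`, `bshiftEquiv_comm`), dag-n15-a
`…NeumannCubeSeam` (`chiCube_kingPrV`).  Nothing in the tree is modified.

WHY.  FILE 123 (dag-n15-w3's `U(m)` η-DEFECT capstone 53 at the cover) bounds `𝔇_π̂(G′_glued, G_glued)` by `D·((L^k)^{−1∕16} + o + o_W + r_D)·e^{−(δ∕16)d}` with EIGHTEEN rows
displayed.  In the GLOBAL SMALL-FIELD GAUGE of FILE 129 (`w ≡ w′ ≡ 1`, `P := N_L ⊗ 1`, `N_V ≡ 0`) twelve of them are identities of the zero operator ∕ of the identity gauge, and the six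
SPECIES rows (`hCloc hAloc hCloc′ hAloc′` and the two-grid FITS `hfitC hfitA`) are — for the transporters `Ad_{e^{ηA}}` of a skew-Hermitian potential — six of the fifteen
`TwoSidedLetters` that dag-n15-c FILE 30 ∕ dag-n15-w2 p648808 produce for a fine potential `A′` in the C² window (sup `≤ r`, all one-step differences `≤ rη′`, all mixed second
differences `≤ rη′²`) and its block mean `Ā′ = gavgM π̂ A′` along King's bond pairing, at RATE `θ = η` (`C_πη′ ≤ 2(d+1)η`).  So the η-defect of the live-background glued propagators
has the RATE `(L^k)^{−1∕16} + c·η`, hypothesis = the small-field window of `A′` only.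

WHAT.
* §1 bookkeeping: `hasMaj_idef_sandwich_zero` (the defect rows of `N_V ≡ 0`; the plain rows by FILE 129 `hasMaj_sandwich_zero`), `rowFit_const_self` (the gauge fits at `w ≡ 1` vanish), `rowFit_smul_of_rowFit` ∕
  `rowFit_smul_of_rowFit₂` (cut fits from coefficient fits: `χ′ = χ∘π̂`, `|χ| ≤ 1`), `gavgM_conjTranspose_of_skew` (the block mean of a skew-Hermitian field is skew-Hermitian),
  ★ `conj_one_exp_eq_expTrField` (the transporter field of 120∕123 at `w ≡ 1`, `U = e^{ηA}` IS n15-w3's `expTrField e η (ad∘A)` — n15-w2 `Phi0_adCLM_eq_mulLeftRight` + `(e^{ηA})ᴴ = e^{−ηA}`).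
* §2 ★★★ `sf_idef_cvGlued` — FILE 123 WITH ALL EIGHTEEN ROWS DISCHARGED, RATE INCLUDED: for odd `L ≥ 7`, `a > 0`, `ι`: `∃ δ w₀ R₀ D, 0 < δ ∧ 0 < R₀ ∧ ∀ mv kk r (k ≥ 1, L^m ≥ w₀) e he,
  ∀ A′ skew-Hermitian on the fine bonds of the cover with the C² window letters at scale r_A, [window smallness, scale·(1+|J⊕J|) ≤ R₀] →
  HasMaj (CvNorm) (ofBlocks … (liftBlk (cvBlk ∘ π̂) ι)) (𝔇_π̂ (cvGlued′ … 1 e^{η′A′} (N′_L⊗1) 0) (cvGlued … 1 e^{ηĀ′} (N_L⊗1) 0)) (D·((L^k)^{−1∕16} + scale·(1+|J⊕J|)·η)·e^{−(δ∕16)d})`,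
  `scale = 14e(2+d)κ_e(2+d)(5+2d)r_A`, `η = L^{−k}`.

HONEST FRAMING ∕ LIMITS.  Assembly of LANDED theorems (one `obtain` of 123's constants, one of the fifteen letters, currency rewrites, one application) + finite-dimensional algebra;
MODEL operator (covariant Laplacian (3.50) ⊗ colour of `Ad_{e^{ηA}}` + the FLAT nonlocal part of [B4-I] (1.69) — NOT Bałaban's `Δ_a(U)` (3.26): no `Q(U)`, no `R(U)`, no `Δ′`);
MODEL class (global gauge; ALL mixed second differences — (3.36) prints `∂*∂A` only); MODEL pairing (coarse field := King block mean of the fine one — [Balaban1985Averaging]'s nonlinear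
average is not used); MODEL carriers; constants crude.  The η-RATE inequality of this kind is NOT PRINTED anywhere ([B9] Thm 3.14 is the DOMAIN-difference template); nothing of
[B5]∕[B6]∕[B9] asserted.  NE2⁺ NOT PRINTED, NOT proved (this is ONE model family's entry-0 defect, not `T4EtaRate.NE2PlusOperator` at the record); N15 NOT discharged; K3⁸ OPEN, skeleton v6
untouched (0∕2); counts of record UNMOVED (typed 28∕28 · discharged 5∕27 · A 5∕28); one finite 𝕋⁴ at fixed ε — NOT infinite volume, NOT OS on ℝ⁴, NOT a mass gap, NOT Clay; R4 closes the
conditional finite-𝕋⁴ rung `BalabanLadder.UV` only.  Restate-immune (no Theses import).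
-/

noncomputable section

open scoped BigOperators Matrix Matrix.Norms.Frobenius

namespace Summit.QuantumFields.YangMills.BalabanUVNodes.N15.Gluing

open Literature.MathematicalPhysics.QuantumFieldTheory.Balaban1983to89
open Literature.MathematicalPhysics.QuantumFieldTheory.Balaban1983to89.B11SectG (BlockNorm HasMaj)
open Literature.MathematicalPhysics.QuantumFieldTheory.Balaban1983to89.T4EtaRateDefect (idef)
open Literature.MathematicalPhysics.QuantumFieldTheory.Balaban1983to89.T4EtaRateCoeffDefect (pull)
open Literature.MathematicalPhysics.QuantumFieldTheory.Balaban1983to89.B6Prop26Gluing (mulOp)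
open Literature.MathematicalPhysics.QuantumFieldTheory.Balaban1983to89.B6UnitTorusCarrier (unitTorusGeo unitTorusGeo_dist_nonneg)
open Literature.MathematicalPhysics.QuantumFieldTheory.King1986.Torus (blockOf)
open Literature.Barriers.QuantumFields (traceForm)
open Literature.MathematicalPhysics.QuantumFieldTheory.Balaban1983to89.Beta.AveragingCorrectionJets (adCLM)
open Summit.QuantumFields.YangMills.BalabanUVNodes.N15.BackgroundLayer (covLapM tCoefA tCoefC gavgM)
open Summit.QuantumFields.YangMills.BalabanUVNodes.N15.VectorPiece (bshiftEquiv kingPrV kingPrV_bshiftEquiv_pow fibre_conn_kingPrV bshiftEquiv_comm)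
open Summit.QuantumFields.YangMills.BalabanUVNodes.N15.MatrixSpecies (mmulOp coordMat basisConst basisConst_nonneg liftBlk liftMap blockAvgV Phi0)
open Summit.QuantumFields.YangMills.BalabanUVNodes.N15.TwoGrid (chiCube abs_chiCube_le_one chiCube_kingPrV)
open Summit.QuantumFields.YangMills.BalabanUVNodes.N15.CurvedSpecies (gaugePair expTrField expTrField_apply curvCoefC_one curvCoefA_one twoSidedLetters_curvCoef_one_of_meanGauge
  coordMat_adCLM_transpose_eq_neg_of_conjTranspose Phi0_adCLM_eq_mulLeftRight conjTranspose_exp_smul_of_conjTranspose)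

variable {d : ℕ}

/-! ## §1 Bookkeeping: the zero rows, the cut fits from the coefficient fits, the transporter field at `w ≡ 1` -/

section Rows

/-- The η-defect rows of `N_V ≡ 0`: `𝔇(S′0T′, S0T) = 0` has every majorant `c·e^{−δd}`, `c ≥ 0`. [folklore] -/
theorem hasMaj_idef_sandwich_zero {g : B6.Geometry} {F₁ F₂ F₁' F₂' : Type} [AddCommGroup F₁] [Module ℝ F₁] [AddCommGroup F₂] [Module ℝ F₂] [AddCommGroup F₁'] [Module ℝ F₁']
    [AddCommGroup F₂'] [Module ℝ F₂'] (b₁ : BlockNorm g F₁) (b₂ : BlockNorm g F₂') (τ₁ : F₁ →ₗ[ℝ] F₁') (τ₂ : F₂ →ₗ[ℝ] F₂') (S' : F₂' →ₗ[ℝ] F₂') (T' : F₁' →ₗ[ℝ] F₁')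
    (S : F₂ →ₗ[ℝ] F₂) (T : F₁ →ₗ[ℝ] F₁) {c δ : ℝ} (hc : 0 ≤ c) (dist : g.Site → g.Site → ℝ) :
    HasMaj b₁ b₂ (idef τ₁ τ₂ (S' ∘ₗ (0 : F₁' →ₗ[ℝ] F₂') ∘ₗ T') (S ∘ₗ (0 : F₁ →ₗ[ℝ] F₂) ∘ₗ T)) (fun y y' => c * Real.exp (-(δ * dist y y'))) := by
  intro y' f _ y
  simp only [idef, LinearMap.zero_comp, LinearMap.comp_zero, sub_zero, LinearMap.zero_apply, b₂.loc_zero]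
  exact mul_nonneg (mul_nonneg hc (Real.exp_nonneg _)) (b₁.loc_nonneg _ _)

variable {ι : Type} [Fintype ι]

/-- A cut fit from a coefficient fit: `χ′ = χ∘π`, `|χ| ≤ 1` ⟹ `Σ_j|(χ′(x′)C′(x′) − χ(πx′)C(πx′))_{ij}| ≤ Σ_j|(C′(x′) − C(πx′))_{ij}|`. [folklore] -/
theorem rowFit_smul_of_rowFit {X X' : Type} (π : X' → X) {χ : X → ℝ} {χ' : X' → ℝ} (hχ : ∀ x', χ' x' = χ (π x')) (hχ1 : ∀ x, |χ x| ≤ 1) (C : X → Matrix ι ι ℝ) (C' : X' → Matrix ι ι ℝ)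
    {b : ℝ} (h : ∀ x' i, ∑ j, |C' x' i j - C (π x') i j| ≤ b) (x' : X') (i : ι) : ∑ j, |(χ' x' • C' x') i j - (χ (π x') • C (π x')) i j| ≤ b := by
  refine le_trans (Finset.sum_le_sum fun j _ => ?_) (h x' i)
  rw [hχ x', Matrix.smul_apply, Matrix.smul_apply, smul_eq_mul, smul_eq_mul, ← mul_sub, abs_mul]
  exact mul_le_of_le_one_left (abs_nonneg _) (hχ1 _)

/-- The same for direction-indexed coefficients. [folklore] -/
theorem rowFit_smul_of_rowFit₂ {X X' K : Type} (π : X' → X) {χ : X → ℝ} {χ' : X' → ℝ} (hχ : ∀ x', χ' x' = χ (π x')) (hχ1 : ∀ x, |χ x| ≤ 1) (C : K → X → Matrix ι ι ℝ)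
    (C' : K → X' → Matrix ι ι ℝ) {b : ℝ} (h : ∀ μ x' i, ∑ j, |C' μ x' i j - C μ (π x') i j| ≤ b) (μ : K) (x' : X') (i : ι) :
    ∑ j, |(χ' x' • C' μ x') i j - (χ (π x') • C μ (π x')) i j| ≤ b :=
  rowFit_smul_of_rowFit π hχ hχ1 (C μ) (C' μ) (h μ) x' i

variable [DecidableEq ι] {mm : Type} [Fintype mm] [DecidableEq mm] (e : Matrix mm mm ℂ ≃L[ℝ] (ι → ℝ))

omit [DecidableEq ι] in
/-- The gauge fits at `w ≡ w′ ≡ 1` vanish (both sandwiches read the same matrix). [folklore] -/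
theorem rowFit_const_self {X' : Type} (W : Matrix ι ι ℝ) {oW : ℝ} (hoW : 0 ≤ oW) (x' : X') (i : ι) : ∑ j, |(fun _ : X' => W) x' i j - W i j| ≤ oW := by
  simp only [sub_self, abs_zero, Finset.sum_const_zero]
  exact hoW

omit [DecidableEq mm] in
/-- The King block mean of a skew-Hermitian field is skew-Hermitian. [folklore] -/
theorem gavgM_conjTranspose_of_skew {X X' J : Type} [Fintype X'] [DecidableEq X] (π : X' → X) {A' : J → X' → Matrix mm mm ℂ} (hA' : ∀ μ x', (A' μ x')ᴴ = -A' μ x') (μ : J) (x : X) :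
    (gavgM (Matrix mm mm ℂ) J π A' μ x)ᴴ = -gavgM (Matrix mm mm ℂ) J π A' μ x := by
  simp only [gavgM, blockAvgV, Matrix.conjTranspose_smul, star_trivial, Matrix.conjTranspose_sum, hA', Finset.sum_neg_distrib, smul_neg]

/-- ★ **THE TRANSPORTER FIELD OF 120∕123 AT `w ≡ 1`, `U = e^{ηA}`, IS `expTrField e η (ad∘A)`** for a skew-Hermitian `A` (n15-w2 `Phi0_adCLM_eq_mulLeftRight` + `(e^{ηA})ᴴ = e^{−ηA}`).
[cite: Balaban1985BackgroundPropagators, (3.37) p.396, (3.50) p.400 (shape: `U′ = exp(iηA′)`, adjoint action)] -/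
theorem conj_one_exp_eq_expTrField {X J : Type} (η : ℝ) {A : J → X → Matrix mm mm ℂ} (hA : ∀ μ x, (A μ x)ᴴ = -A μ x) :
    (fun μ x => coordMat e (ContinuousLinearMap.mulLeftRight ℝ (Matrix mm mm ℂ) ((1 : Matrix mm mm ℂ) * NormedSpace.exp (η • A μ x) * (1 : Matrix mm mm ℂ)ᴴ)
        ((1 : Matrix mm mm ℂ) * NormedSpace.exp (η • A μ x) * (1 : Matrix mm mm ℂ)ᴴ)ᴴ)) = expTrField e η (fun μ x => adCLM ℝ (A μ x)) := by
  funext μ x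
  rw [expTrField_apply, Phi0_adCLM_eq_mulLeftRight, Matrix.conjTranspose_one, Matrix.one_mul, Matrix.mul_one, conjTranspose_exp_smul_of_conjTranspose (hA μ x)]
  rfl

end Rows

/-! ## §2 The two-spacing η-defect of the live-background glued propagators, every row produced -/

section Defect

variable {L : ℕ} [NeZero L]

set_option maxHeartbeats 800000 in
/-- ★★★ **THE η-DEFECT OF THE LIVE-BACKGROUND GLUED PROPAGATORS AT THE COVER IN THE GLOBAL SMALL-FIELD GAUGE — FILE 123 `uN_idef_cvGlued` WITH ALL EIGHTEEN ROWS DISCHARGED.**  For odd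
`L ≥ 7`, `a > 0`, a colour index `ι`: there are `δ, R₀ > 0`, `w₀`, `D` such that on every doubled torus `2L·L^m` of the cover (`k ≥ 1`, `L^m ≥ w₀`) and every refinement `r`, for
trace-form coordinates `e` of `𝔲(m)`, EVERY SKEW-HERMITIAN gauge potential `A′` on the FINE bonds in the C² small-field window at scale `r_A` (sup `≤ r_A`, all one-step differences
`≤ r_Aη′`, all mixed second differences `≤ r_Aη′²`, `η′ = (L^rL^k)^{−1}`) with `2(2+d)(5+2d)r_A ≤ 1` and `scale·(1 + |J ⊕ J|) ≤ R₀`: the η-defect along King's bond pairing `π̂` between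
the FINE glued operator (transporters `Ad_{e^{η′A′}}`, gauges `1`, summand `N′_L ⊗ 1`, perturbation `0`) and the COARSE one for the block mean `Ā′ = gavgM π̂ A′` (transporters
`Ad_{e^{ηĀ′}}`, `η = L^{−k}`) satisfies `𝔇 ≤ D·((L^k)^{−1∕16} + scale·(1+|J⊕J|)·η)·e^{−(δ∕16)|y−y′|}` blockwise, `scale = 14e(2+d)κ_e(2+d)(5+2d)r_A` — an η-RATE with NO displayed
row.  MODEL operator ∕ class ∕ pairing ∕ carriers; NOT [B9] Thm 3.14 (domain differences) and not any printed estimate.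
[cite: Balaban1985BackgroundPropagators, Thm 3.14 pp.426–427 (template), (3.35)–(3.37) p.396, (3.50)–(3.52) p.400, (3.62)–(3.65) pp.402–403; King1986, p.664 (pairing), Prop. 3.9 (3.73) p.665 (rate shape); Balaban1984PropagatorsII, (2.133)–(2.136) p.247] -/
theorem sf_idef_cvGlued (hL : Odd L ∧ 1 < L) (hL7 : 7 ≤ L) {a : ℝ} (ha : 0 < a) (ι : Type) [Fintype ι] [DecidableEq ι] :
    ∃ δ w₀ R₀ D : ℝ, 0 < δ ∧ 0 < R₀ ∧
      ∀ (mv kk r : ℕ), 1 ≤ kk → w₀ ≤ ((L ^ mv : ℕ) : ℝ) →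
      ∀ {mm : Type} [Fintype mm] [DecidableEq mm] (e : Matrix mm mm ℂ ≃L[ℝ] (ι → ℝ)), (∀ A B : Matrix mm mm ℂ, traceForm A B = e A ⬝ᵥ e B) →
      ∀ (A' : Fin (d + 1) → CvX' d L mv kk r hL → Matrix mm mm ℂ), (∀ μ x', (A' μ x')ᴴ = -A' μ x') →
      ∀ (rA : ℝ), 0 ≤ rA → (∀ μ x', ‖A' μ x'‖ ≤ rA) →
        (∀ μ κ x', ‖A' μ (bshiftEquiv (cvM d L mv kk hL) (L ^ r * L ^ kk) κ x') - A' μ x'‖ ≤ rA * ((((L ^ r * L ^ kk : ℕ) : ℝ))⁻¹)) →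
        (∀ μ κ x', ‖(A' μ (bshiftEquiv (cvM d L mv kk hL) (L ^ r * L ^ kk) κ x') - A' μ x') -
            (A' μ (bshiftEquiv (cvM d L mv kk hL) (L ^ r * L ^ kk) κ ((bshiftEquiv (cvM d L mv kk hL) (L ^ r * L ^ kk) μ).symm x')) -
              A' μ ((bshiftEquiv (cvM d L mv kk hL) (L ^ r * L ^ kk) μ).symm x'))‖ ≤ rA * ((((L ^ r * L ^ kk : ℕ) : ℝ))⁻¹) * ((((L ^ r * L ^ kk : ℕ) : ℝ))⁻¹)) →
        2 * ((1 + Fintype.card (Fin (d + 1))) * ((3 + 2 * ((d : ℝ) + 1)) * rA)) ≤ 1 →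
        (14 * Real.exp 1 * (1 + Fintype.card (Fin (d + 1))) * basisConst e * ((1 + Fintype.card (Fin (d + 1))) * ((3 + 2 * ((d : ℝ) + 1)) * rA))) * (1 + Fintype.card (Fin (d + 1) ⊕ Fin (d + 1))) ≤ R₀ →
        HasMaj (CvNorm d L mv kk hL ι) (BlockNorm.ofBlocks (unitTorusGeo L kk (cvM d L mv kk hL)) (liftBlk (cvBlk d L mv kk hL ∘ kingPrV L kk r (cvM d L mv kk hL)) ι)) (idef (pull (liftMap (kingPrV L kk r (cvM d L mv kk hL)) ι)) (pull (liftMap (kingPrV L kk r (cvM d L mv kk hL)) ι))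
            (cvGlued' d L mv kk r hL a ((((L ^ r * L ^ kk : ℕ) : ℝ))⁻¹) ι e (fun _ _ => (1 : Matrix mm mm ℂ)) (fun μ x' => NormedSpace.exp (((((L ^ r * L ^ kk : ℕ) : ℝ))⁻¹) • A' μ x')) (cvNL' d L mv kk r hL a ι) (fun _ => 0))
            (cvGlued d L mv kk hL a ((((L ^ kk : ℕ) : ℝ))⁻¹) ι e (fun _ _ => (1 : Matrix mm mm ℂ)) (fun μ x => NormedSpace.exp (((((L ^ kk : ℕ) : ℝ))⁻¹) • gavgM (Matrix mm mm ℂ) (Fin (d + 1)) (kingPrV L kk r (cvM d L mv kk hL)) A' μ x)) (cvNL d L mv kk hL a ι) (fun _ => 0)))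
          (fun y y' => D * ((((L ^ kk : ℕ) : ℝ)) ^ (-(1 / 16 : ℝ)) + (14 * Real.exp 1 * (1 + Fintype.card (Fin (d + 1))) * basisConst e * ((1 + Fintype.card (Fin (d + 1))) * ((3 + 2 * ((d : ℝ) + 1)) * rA))) * (1 + Fintype.card (Fin (d + 1) ⊕ Fin (d + 1))) * ((((L ^ kk : ℕ) : ℝ))⁻¹)) *
            Real.exp (-(δ / 16 * (unitTorusGeo L kk (cvM d L mv kk hL)).dist y y'))) := by
  have hLpos : 0 < L := Nat.pos_of_ne_zero (NeZero.ne L)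
  have hL1 : (1 : ℝ) ≤ L := by exact_mod_cast hLpos
  obtain ⟨δ, w₀, R₀, θ₀, D, hδ, hR₀, hθ₀, H⟩ := uN_idef_cvGlued (d := d) hL hL7 ha ι
  refine ⟨δ, w₀, R₀, D, hδ, hR₀, fun mv kk r hk hw₀ => ?_⟩
  intro mm _ _ e he A' hA' rA hrA h1 h2 h3 hr2 hRle
  -- the two spacings
  have hkpos : (0 : ℝ) < ((L ^ kk : ℕ) : ℝ) := Nat.cast_pos.mpr (pow_pos hLpos kk)
  have hrkpos : (0 : ℝ) < ((L ^ r * L ^ kk : ℕ) : ℝ) := Nat.cast_pos.mpr (Nat.mul_pos (pow_pos hLpos r) (pow_pos hLpos kk))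
  have hη : (0 : ℝ) < ((((L ^ kk : ℕ) : ℝ))⁻¹) := inv_pos.mpr hkpos
  have hη' : (0 : ℝ) < ((((L ^ r * L ^ kk : ℕ) : ℝ))⁻¹) := inv_pos.mpr hrkpos
  have hN : ((((L ^ kk : ℕ) : ℝ))⁻¹) = ((L ^ r : ℕ) : ℝ) * ((((L ^ r * L ^ kk : ℕ) : ℝ))⁻¹) := by
    have hr0 : ((L ^ r : ℕ) : ℝ) ≠ 0 := Nat.cast_ne_zero.mpr (pow_ne_zero _ (NeZero.ne L))
    rw [Nat.cast_mul]; field_simp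
  have hη1 : ((((L ^ kk : ℕ) : ℝ))⁻¹) ≤ 1 := inv_le_one_of_one_le₀ (by exact_mod_cast Nat.one_le_pow kk L hLpos)
  have hC₀ : (0 : ℝ) ≤ 2 * ((d : ℝ) + 1) := by positivity
  have hCθ : ((2 * ((d + 1) * (L ^ r - 1)) : ℕ) : ℝ) * ((((L ^ r * L ^ kk : ℕ) : ℝ))⁻¹) ≤ 2 * ((d : ℝ) + 1) * ((((L ^ kk : ℕ) : ℝ))⁻¹) := by
    have hsub : (((L ^ r - 1 : ℕ)) : ℝ) ≤ ((L ^ r : ℕ) : ℝ) := by exact_mod_cast Nat.sub_le _ _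
    have hcast : ((2 * ((d + 1) * (L ^ r - 1)) : ℕ) : ℝ) = 2 * ((d : ℝ) + 1) * (((L ^ r - 1 : ℕ)) : ℝ) := by push_cast; ring
    rw [hcast, hN]
    have hr0 : (0 : ℝ) < ((L ^ r : ℕ) : ℝ) := Nat.cast_pos.mpr (pow_pos hLpos r)
    calc 2 * ((d : ℝ) + 1) * (((L ^ r - 1 : ℕ)) : ℝ) * ((((L ^ r * L ^ kk : ℕ) : ℝ))⁻¹) ≤ 2 * ((d : ℝ) + 1) * ((L ^ r : ℕ) : ℝ) * ((((L ^ r * L ^ kk : ℕ) : ℝ))⁻¹) :=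
          mul_le_mul_of_nonneg_right (mul_le_mul_of_nonneg_left hsub hC₀) hη'.le
      _ = 2 * ((d : ℝ) + 1) * (((L ^ r : ℕ) : ℝ) * ((((L ^ r * L ^ kk : ℕ) : ℝ))⁻¹)) := by ring
  -- the geometry of King's bond pairing on the cover
  have hcomm := fun μ κ (x : CvX' d L mv kk r hL) => bshiftEquiv_comm (cvM d L mv kk hL) (L ^ r * L ^ kk) μ κ x
  have hconn := fun (f : CvX' d L mv kk r hL → Matrix mm mm ℂ) (β : ℝ)
      (hf : ∀ κ x, ‖f (bshiftEquiv (cvM d L mv kk hL) (L ^ r * L ^ kk) κ x) - f x‖ ≤ β) => fibre_conn_kingPrV L kk r (cvM d L mv kk hL) f β hf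
  have hblk := fun μ (x' : CvX' d L mv kk r hL) => kingPrV_bshiftEquiv_pow L kk r (cvM d L mv kk hL) μ x'
  -- skewness, in the matrix algebra and in coordinates
  have hAm : ∀ μ x, (gavgM (Matrix mm mm ℂ) (Fin (d + 1)) (kingPrV L kk r (cvM d L mv kk hL)) A' μ x)ᴴ = -gavgM (Matrix mm mm ℂ) (Fin (d + 1)) (kingPrV L kk r (cvM d L mv kk hL)) A' μ x := gavgM_conjTranspose_of_skew (kingPrV L kk r (cvM d L mv kk hL)) hA'
  have hA'c := fun μ x' => coordMat_adCLM_transpose_eq_neg_of_conjTranspose e he (hA' μ x')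
  have hAmc := fun μ x => coordMat_adCLM_transpose_eq_neg_of_conjTranspose e he (hAm μ x)
  -- the fifteen letters at rate `θ = η`
  obtain ⟨hc, hcA, hc', hcA', hfc, hfA, -, -, -, -, -, -, -, -, -⟩ :=
    twoSidedLetters_curvCoef_one_of_meanGauge e (π := (kingPrV L kk r (cvM d L mv kk hL))) (s := bshiftEquiv (cvM d L mv kk hL) (L ^ kk))
      (s' := bshiftEquiv (cvM d L mv kk hL) (L ^ r * L ^ kk)) (N := L ^ r) (θ := ((((L ^ kk : ℕ) : ℝ))⁻¹)) (Cπ := ((2 * ((d + 1) * (L ^ r - 1)) : ℕ) : ℝ)) (C₀ := 2 * ((d : ℝ) + 1))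
      hcomm hconn hblk hη' hN hη hη1 le_rfl hC₀ hCθ hrA hr2 hA'c hAmc h1 h2 h3
  -- currency: curved-at-flat-base coefficients = exact transport coefficients; the transporter field at `w ≡ 1`
  rw [curvCoefC_one, curvCoefA_one, ← conj_one_exp_eq_expTrField e ((((L ^ kk : ℕ) : ℝ))⁻¹) hAm] at hc hcA
  rw [curvCoefC_one, curvCoefA_one, ← conj_one_exp_eq_expTrField e ((((L ^ r * L ^ kk : ℕ) : ℝ))⁻¹) hA'] at hc' hcA'
  rw [curvCoefC_one, curvCoefC_one, ← conj_one_exp_eq_expTrField e ((((L ^ kk : ℕ) : ℝ))⁻¹) hAm, ← conj_one_exp_eq_expTrField e ((((L ^ r * L ^ kk : ℕ) : ℝ))⁻¹) hA'] at hfc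
  rw [curvCoefA_one, curvCoefA_one, ← conj_one_exp_eq_expTrField e ((((L ^ kk : ℕ) : ℝ))⁻¹) hAm, ← conj_one_exp_eq_expTrField e ((((L ^ r * L ^ kk : ℕ) : ℝ))⁻¹) hA'] at hfA
  -- the cut fits (`χ′ = χ∘π̂`, `|χ| ≤ 1`)
  have hχ : ∀ (k : Fin (d + 1) → ZMod (2 * L)) (x' : CvX' d L mv kk r hL), cvChi' d L mv kk r hL k x' = cvChi d L mv kk hL k ((kingPrV L kk r (cvM d L mv kk hL)) x') :=
    fun k x' => (chiCube_kingPrV L kk r _ _ x').symm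
  have hχ1 : ∀ (k : Fin (d + 1) → ZMod (2 * L)) (x : CvX d L mv kk hL), |cvChi d L mv kk hL k x| ≤ 1 := fun k x => abs_chiCube_le_one _ x
  -- nonnegativity of the scale
  have hκ0 : 0 ≤ basisConst e := basisConst_nonneg e
  have hS0 : 0 ≤ (14 * Real.exp 1 * (1 + Fintype.card (Fin (d + 1))) * basisConst e * ((1 + Fintype.card (Fin (d + 1))) * ((3 + 2 * ((d : ℝ) + 1)) * rA))) := by positivity
  have hSη0 : 0 ≤ (14 * Real.exp 1 * (1 + Fintype.card (Fin (d + 1))) * basisConst e * ((1 + Fintype.card (Fin (d + 1))) * ((3 + 2 * ((d : ℝ) + 1)) * rA))) * ((((L ^ kk : ℕ) : ℝ))⁻¹) := mul_nonneg hS0 hη.le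
  have hmain := H mv kk r hk hw₀ e he (fun _ _ => (1 : Matrix mm mm ℂ)) (fun _ _ => (1 : Matrix mm mm ℂ)) (fun _ _ => by rw [Matrix.conjTranspose_one, Matrix.mul_one])
    (fun _ _ => by rw [Matrix.conjTranspose_one, Matrix.mul_one]) (fun μ x => NormedSpace.exp (((((L ^ kk : ℕ) : ℝ))⁻¹) • gavgM (Matrix mm mm ℂ) (Fin (d + 1)) (kingPrV L kk r (cvM d L mv kk hL)) A' μ x)) (fun μ x' => NormedSpace.exp (((((L ^ r * L ^ kk : ℕ) : ℝ))⁻¹) • A' μ x')) (cvNL d L mv kk hL a ι) (cvNL' d L mv kk r hL a ι) (fun _ => 0) (fun _ => 0)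
    (14 * Real.exp 1 * (1 + Fintype.card (Fin (d + 1))) * basisConst e * ((1 + Fintype.card (Fin (d + 1))) * ((3 + 2 * ((d : ℝ) + 1)) * rA))) 0 0 0 ((14 * Real.exp 1 * (1 + Fintype.card (Fin (d + 1))) * basisConst e * ((1 + Fintype.card (Fin (d + 1))) * ((3 + 2 * ((d : ℝ) + 1)) * rA))) * ((((L ^ kk : ℕ) : ℝ))⁻¹)) 0 ((14 * Real.exp 1 * (1 + Fintype.card (Fin (d + 1))) * basisConst e * ((1 + Fintype.card (Fin (d + 1))) * ((3 + 2 * ((d : ℝ) + 1)) * rA))) * ((((L ^ kk : ℕ) : ℝ))⁻¹) * (1 + Fintype.card (Fin (d + 1) ⊕ Fin (d + 1))) + 0) 0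
    hS0 le_rfl le_rfl hSη0 le_rfl le_rfl (by rw [add_zero]; exact hRle) le_rfl hθ₀.le
    (fun k => conj_one_eq_sub_zero e (cvNL d L mv kk hL a ι)) (fun k => conj_one_eq_sub_zero e (cvNL' d L mv kk r hL a ι))
    (fun k x _ i => hc x i) (fun k j' x _ i => hcA j' x i) (fun k x' _ i => hc' x' i) (fun k j' x' _ i => hcA' j' x' i)
    (fun k x' i => rowFit_smul_of_rowFit (kingPrV L kk r (cvM d L mv kk hL)) (hχ k) (hχ1 k) _ _ hfc x' i)
    (fun k j' x' i => rowFit_smul_of_rowFit₂ (kingPrV L kk r (cvM d L mv kk hL)) (hχ k) (hχ1 k) _ _ hfA j' x' i)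
    (fun k => hasMaj_sandwich_zero _ _ _ _ le_rfl _) (fun k => hasMaj_sandwich_zero _ _ _ _ le_rfl _) (fun k => hasMaj_idef_sandwich_zero _ _ _ _ _ _ _ _ le_rfl _)
    (fun k => hasMaj_sandwich_zero _ _ _ _ le_rfl _) (fun k => hasMaj_sandwich_zero _ _ _ _ le_rfl _) (fun k => hasMaj_idef_sandwich_zero _ _ _ _ _ _ _ _ le_rfl _)
    (fun k x' i => rowFit_const_self _ le_rfl x' i) (fun k x' i => rowFit_const_self _ le_rfl x' i)
  refine hmain.mono fun y y' => le_of_eq ?_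
  ring

end Defect

end Summit.QuantumFields.YangMills.BalabanUVNodes.N15.Gluing

end
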